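import Literature.MathematicalPhysics.QuantumManyBody.GroundStateFeynmanKacFreeForm
import Literature.MathematicalPhysics.QuantumManyBody.PeriodicFeynmanKacTrialState
import Mathlib.Analysis.InnerProductSpace.Calculus
import Mathlib.Analysis.SpecialFunctions.Sqrt
import HarnessLib

/-!
# Nonnegative trial states: the smoothed modulus of an admissible trial state

Helper for item `GroundStateAccessible` (stmt-AtomisticToContinuum-12069) of route `BECInsertionVariance`
(`Summit.AtomisticToContinuum.BoseEinsteinCondensation.Theses.BECInsertionVariance.GroundStateAccessible`),
existence half, GENERAL pair potentials (hard cores allowed): the variational problem over the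
symmetric `C¹` Dirichlet core `TrialState N L` has NONNEGATIVE near-minimisers.

For an admissible trial state `Φ` (complex, `C¹`, Dirichlet, Bose symmetric, normalised) and
`ε > 0` put `g_ε = √(|Φ|² + ε²) − ε`. Then `g_ε` is `C¹`, `0 ≤ g_ε ≤ |Φ|`, `|Φ| − g_ε ≤ ε`, `g_ε`
vanishes where `Φ` does and is symmetric, and (the `C¹` diamagnetic inequality)
`|∂_u g_ε| = |Re⟨Φ, ∂_u Φ⟩| / √(|Φ|² + ε²) ≤ |∂_u Φ|` for every direction `u`
(`norm_fderiv_smoothAbs_le`; the lemma names keep `smoothAbs` for this function, which is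
written out rather than defined). Hence the normalised `g_ε/‖g_ε‖₂` is an admissible, nonnegative
trial state whose energy is at most `‖g_ε‖₂⁻² ⟨Φ, H_N Φ⟩`, and `‖g_ε‖₂² ≥ 1 − 2ε sup|Φ| · |Λ^N| → 1`:
`exists_nonneg_trialState_energy_le` — for every `δ ∈ (0, 1)` a nonnegative trial state with
energy `≤ (1 − δ)⁻¹ ⟨Φ, H_N Φ⟩`. This is the variational half of "the ground state may be chosen
nonnegative" (Reed–Simon IV Thm XIII.46 remark / LSSY Ch. 7: `⟨|Ψ|, H|Ψ|⟩ ≤ ⟨Ψ, HΨ⟩`), carried out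
on the `C¹` core, where `|Φ|` itself is not admissible.
-/

noncomputable section

open MeasureTheory Filter Set
open scoped ENNReal NNReal Topology InnerProductSpace

namespace Summit.AtomisticToContinuum.BoseEinsteinCondensation.Theorems.BECInsertionVariance

open Literature.MathematicalPhysics.QuantumManyBody.BoseGas

variable {N : ℕ}

/-! ### The smoothed modulus `X ↦ √(|ψ X|² + ε²) − ε` (written out; no auxiliary definition) -/

section SmoothAbs

variable {ε : ℝ} {ψ : Config N → ℂ}

/-- `g_ε ≥ 0` for `ε ≥ 0`. [folklore] -/
theorem smoothAbs_nonneg (hε : 0 ≤ ε) (X : Config N) :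
    0 ≤ Real.sqrt (‖ψ X‖ ^ 2 + ε ^ 2) - ε := by
  have : ε ≤ Real.sqrt (‖ψ X‖ ^ 2 + ε ^ 2) := by
    rw [show ε = Real.sqrt (ε ^ 2) from (Real.sqrt_sq hε).symm]
    exact Real.sqrt_le_sqrt (by rw [Real.sq_sqrt (sq_nonneg _)]; nlinarith [norm_nonneg (ψ X)])
  linarith

/-- `g_ε ≤ |ψ|` for `ε ≥ 0`. [folklore] -/
theorem smoothAbs_le_norm (hε : 0 ≤ ε) (X : Config N) :
    Real.sqrt (‖ψ X‖ ^ 2 + ε ^ 2) - ε ≤ ‖ψ X‖ := by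
  have h : Real.sqrt (‖ψ X‖ ^ 2 + ε ^ 2) ≤ ‖ψ X‖ + ε := by
    rw [Real.sqrt_le_left (by positivity)]
    nlinarith [norm_nonneg (ψ X)]
  linarith

/-- `|ψ| − ε ≤ g_ε`. [folklore] -/
theorem norm_sub_le_smoothAbs (X : Config N) :
    ‖ψ X‖ - ε ≤ Real.sqrt (‖ψ X‖ ^ 2 + ε ^ 2) - ε := by
  have h : ‖ψ X‖ ≤ Real.sqrt (‖ψ X‖ ^ 2 + ε ^ 2) := by
    rw [show ‖ψ X‖ = Real.sqrt (‖ψ X‖ ^ 2) from (Real.sqrt_sq (norm_nonneg _)).symm]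
    exact Real.sqrt_le_sqrt (by rw [Real.sq_sqrt (sq_nonneg _)]; nlinarith)
  linarith

/-- `g_ε` vanishes where `ψ` does (`ε ≥ 0`). [folklore] -/
theorem smoothAbs_eq_zero_of_eq_zero (hε : 0 ≤ ε) {X : Config N} (h : ψ X = 0) :
    Real.sqrt (‖ψ X‖ ^ 2 + ε ^ 2) - ε = 0 := by
  simp [h, Real.sqrt_sq hε]

/-- `g_ε` is `C¹` for a `C¹` function `ψ` and `ε ≠ 0`. [folklore] -/
theorem contDiff_smoothAbs (hψ : ContDiff ℝ 1 ψ) (hε : ε ≠ 0) :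
    ContDiff ℝ 1 (fun X => Real.sqrt (‖ψ X‖ ^ 2 + ε ^ 2) - ε) := by
  refine ContDiff.sub ?_ contDiff_const
  refine ContDiff.sqrt ((hψ.norm_sq ℝ).add contDiff_const) fun X => ?_
  positivity

/-- **The `C¹` diamagnetic inequality**: `|∂_u g_ε(X)| ≤ |∂_u ψ(X)|` for every direction `u`
(`ε ≠ 0`, `ψ` differentiable at `X`): `∂_u g_ε = Re⟨ψ, ∂_u ψ⟩ / √(|ψ|² + ε²)` and
`|ψ| ≤ √(|ψ|² + ε²)`. [cite: LSSY2005, Ch. 7 (after (7.1))] -/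
theorem norm_fderiv_smoothAbs_le {X : Config N} (hψ : DifferentiableAt ℝ ψ X) (hε : ε ≠ 0)
    (u : Config N) :
    ‖fderiv ℝ (fun X => Real.sqrt (‖ψ X‖ ^ 2 + ε ^ 2) - ε) X u‖ ≤ ‖fderiv ℝ ψ X u‖ := by
  set s : ℝ := Real.sqrt (‖ψ X‖ ^ 2 + ε ^ 2) with hs
  have hpos : 0 < ‖ψ X‖ ^ 2 + ε ^ 2 := by positivity
  have hs0 : 0 < s := Real.sqrt_pos.2 hpos
  have hsge : ‖ψ X‖ ≤ s := by
    rw [hs, show ‖ψ X‖ = Real.sqrt (‖ψ X‖ ^ 2) from (Real.sqrt_sq (norm_nonneg _)).symm]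
    exact Real.sqrt_le_sqrt (by rw [Real.sq_sqrt (sq_nonneg _)]; nlinarith)
  have h1 : HasFDerivAt (fun Y => ‖ψ Y‖ ^ 2) (2 • (innerSL ℝ (ψ X)).comp (fderiv ℝ ψ X)) X :=
    hψ.hasFDerivAt.norm_sq
  have h2 : HasFDerivAt (fun Y => ‖ψ Y‖ ^ 2 + ε ^ 2) (2 • (innerSL ℝ (ψ X)).comp (fderiv ℝ ψ X)) X :=
    h1.add_const _
  have h3 := (h2.sqrt hpos.ne').sub_const ε
  have h4 : fderiv ℝ (fun X => Real.sqrt (‖ψ X‖ ^ 2 + ε ^ 2) - ε) X =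
      (1 / (2 * Real.sqrt (‖ψ X‖ ^ 2 + ε ^ 2))) • (2 • (innerSL ℝ (ψ X)).comp (fderiv ℝ ψ X)) :=
    h3.fderiv
  have h5 : fderiv ℝ (fun X => Real.sqrt (‖ψ X‖ ^ 2 + ε ^ 2) - ε) X u =
      ⟪ψ X, fderiv ℝ ψ X u⟫_ℝ / s := by
    rw [h4, ← hs]
    simp only [smul_apply, ContinuousLinearMap.comp_apply, innerSL_apply_apply, smul_eq_mul,
      nsmul_eq_mul, Nat.cast_ofNat]
    field_simp
  rw [h5, Real.norm_eq_abs, abs_div, abs_of_pos hs0, div_le_iff₀ hs0]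
  calc |⟪ψ X, fderiv ℝ ψ X u⟫_ℝ| ≤ ‖ψ X‖ * ‖fderiv ℝ ψ X u‖ := abs_real_inner_le_norm _ _
    _ ≤ s * ‖fderiv ℝ ψ X u‖ := by gcongr
    _ = ‖fderiv ℝ ψ X u‖ * s := mul_comm _ _

/-- Kinetic comparison: `|∇ g_ε|² ≤ |∇ ψ|²` pointwise (coordinatewise diamagnetic inequality).
[cite: LSSY2005, Ch. 7 (after (7.1))] -/
theorem realKinetic_smoothAbs_le (hψ : Differentiable ℝ ψ) (hε : ε ≠ 0) (X : Config N) :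
    realKinetic (fun X => Real.sqrt (‖ψ X‖ ^ 2 + ε ^ 2) - ε) X ≤ kineticDensity ψ X := by
  unfold realKinetic kineticDensity
  refine Finset.sum_le_sum fun i _ => Finset.sum_le_sum fun k _ => ?_
  have h := norm_fderiv_smoothAbs_le (hψ X) hε (Pi.single i (EuclideanSpace.single k (1 : ℝ)))
  have h' : (‖fderiv ℝ (fun X => Real.sqrt (‖ψ X‖ ^ 2 + ε ^ 2) - ε) X
      (Pi.single i (EuclideanSpace.single k (1 : ℝ)))‖₊ : ℝ≥0∞) ≤
      ‖fderiv ℝ ψ X (Pi.single i (EuclideanSpace.single k (1 : ℝ)))‖₊ := by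
    exact_mod_cast h
  exact pow_le_pow_left' h' 2

end SmoothAbs

/-- **Energy comparison under a real contraction of the wave function.** If the wave function of
the trial state `Ψ'` is `c · g` with `g` real `C¹`, `|g| ≤ |Ψ.ψ|` and `|∂_u g| ≤ |∂_u Ψ.ψ|`
coordinatewise (as for the smoothed modulus), then `⟨Ψ', H_N Ψ'⟩ ≤ c² ⟨Ψ, H_N Ψ⟩`. [folklore] -/
theorem energy_le_of_contraction {L : ℝ} (v : ℝ → ℝ≥0∞) (Ψ Ψ' : TrialState N L) {c : ℝ}
    {g : Config N → ℝ} (hg : ContDiff ℝ 1 g) (hΨ' : Ψ'.ψ = fun X => (((c * g X : ℝ)) : ℂ))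
    (hkin : ∀ X, realKinetic g X ≤ kineticDensity Ψ.ψ X) (hle : ∀ X, |g X| ≤ ‖Ψ.ψ X‖) :
    energy v Ψ' ≤ ENNReal.ofReal (c ^ 2) * energy v Ψ := by
  have hgd : Differentiable ℝ g := hg.differentiable one_ne_zero
  have hcgd : Differentiable ℝ fun Y => c * g Y := (differentiable_const c).mul hgd
  unfold energy
  rw [← lintegral_const_mul' _ _ ENNReal.ofReal_ne_top]
  refine lintegral_mono fun X => ?_
  have hk : kineticDensity Ψ'.ψ X = ENNReal.ofReal (c ^ 2) * realKinetic g X := by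
    rw [hΨ', kineticDensity_ofReal hcgd, realKinetic_const_mul_periodic hgd]
  have hn : ((‖Ψ'.ψ X‖₊ : ℝ≥0∞)) ^ 2 = ENNReal.ofReal (c ^ 2) * ENNReal.ofReal (g X ^ 2) := by
    rw [hΨ', ennnorm_sq_ofReal_periodic, mul_pow, ENNReal.ofReal_mul (sq_nonneg _)]
  have hn' : ENNReal.ofReal (g X ^ 2) ≤ ((‖Ψ.ψ X‖₊ : ℝ≥0∞)) ^ 2 := by
    rw [← enorm_eq_nnnorm, ← ofReal_norm, ← ENNReal.ofReal_pow (norm_nonneg _)]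
    exact ENNReal.ofReal_le_ofReal (by rw [← sq_abs]; exact pow_le_pow_left₀ (abs_nonneg _) (hle X) 2)
  rw [hk, hn, mul_add]
  calc ENNReal.ofReal (c ^ 2) * realKinetic g X +
        interaction v X * (ENNReal.ofReal (c ^ 2) * ENNReal.ofReal (g X ^ 2))
      = ENNReal.ofReal (c ^ 2) * realKinetic g X +
        ENNReal.ofReal (c ^ 2) * (interaction v X * ENNReal.ofReal (g X ^ 2)) := by ring
    _ ≤ ENNReal.ofReal (c ^ 2) * kineticDensity Ψ.ψ X +
        ENNReal.ofReal (c ^ 2) * (interaction v X * ((‖Ψ.ψ X‖₊ : ℝ≥0∞)) ^ 2) := by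
        gcongr
        · exact hkin X

/-- **Nonnegative near-minimisers.** For every admissible trial state `Φ`, every pair profile `v`
and every `δ ∈ (0, 1)` there is an admissible trial state `Φ'` with NONNEGATIVE REAL wave function
(`Φ'.ψ X = |Φ'.ψ X|`) and `⟨Φ', H_N Φ'⟩ ≤ (1 − δ)⁻¹ ⟨Φ, H_N Φ⟩`: the normalised smoothed modulus
`g_ε/‖g_ε‖₂`, `g_ε = √(|Φ|² + ε²) − ε`, with `ε` so small that `‖g_ε‖₂² ≥ 1 − δ`.
[cite: LSSY2005, Ch. 7 (after (7.1))] -/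
theorem exists_nonneg_trialState_energy_le {L : ℝ} (Φ : TrialState N L) (v : ℝ → ℝ≥0∞) {δ : ℝ}
    (hδ : 0 < δ) (hδ1 : δ < 1) :
    ∃ Φ' : TrialState N L, (∀ X, Φ'.ψ X = ((‖Φ'.ψ X‖ : ℝ) : ℂ)) ∧
      energy v Φ' ≤ (ENNReal.ofReal (1 - δ))⁻¹ * energy v Φ := by
  set ψ := Φ.ψ with hψdef
  have hψC : ContDiff ℝ 1 ψ := Φ.contDiff
  have hψc : Continuous ψ := hψC.continuous
  -- a bound `M` for `|ψ|`
  have hcs : HasCompactSupport ψ :=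
    HasCompactSupport.intro (isCompact_closedBall (0 : Config N) (3 * |L|))
      fun X hX => Φ.eq_zero X fun hb => hX (boxN_subset_closedBall N L hb)
  obtain ⟨M0, hM0⟩ := hcs.exists_bound_of_continuous hψc
  set M : ℝ := max M0 0 with hMdef
  have hM0' : 0 ≤ M := le_max_right _ _
  have hM : ∀ X, ‖ψ X‖ ≤ M := fun X => (hM0 X).trans (le_max_left _ _)
  -- the volume of the box and the choice of `ε`
  set V : ℝ := (volume (boxN N L)).toReal with hVdef
  have hV0 : 0 ≤ V := ENNReal.toReal_nonneg
  have hvol : volume (boxN N L) = ENNReal.ofReal V := (ENNReal.ofReal_toReal (volume_boxN_lt_top N L).ne).symm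
  set ε : ℝ := δ / (2 * M * V + 1) with hεdef
  have hε : 0 < ε := div_pos hδ (by positivity)
  have hεδ : 2 * ε * M * V ≤ δ := by
    rw [hεdef]
    rw [show 2 * (δ / (2 * M * V + 1)) * M * V = δ * (2 * M * V / (2 * M * V + 1)) by ring]
    calc δ * (2 * M * V / (2 * M * V + 1)) ≤ δ * 1 :=
          mul_le_mul_of_nonneg_left ((div_le_one (by positivity)).2 (by linarith)) hδ.le
      _ = δ := mul_one δ
  -- the smoothed modulus
  set g : Config N → ℝ := fun X => Real.sqrt (‖ψ X‖ ^ 2 + ε ^ 2) - ε with hgdef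
  have hgC : ContDiff ℝ 1 g := contDiff_smoothAbs hψC hε.ne'
  have hgm : Measurable g := hgC.continuous.measurable
  have hg0 : ∀ X, 0 ≤ g X := smoothAbs_nonneg hε.le
  have hgle : ∀ X, g X ≤ ‖ψ X‖ := smoothAbs_le_norm hε.le
  have hg0' : ∀ X, X ∉ boxN N L → g X = 0 := fun X hX =>
    smoothAbs_eq_zero_of_eq_zero hε.le (Φ.eq_zero X hX)
  -- the squared norm `nε = ∫ g²` : `1 - δ ≤ nε ≤ 1`
  set nε : ℝ≥0∞ := ∫⁻ X, ENNReal.ofReal (g X ^ 2) with hnεdef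
  have hnε1 : nε ≤ 1 := by
    rw [← Φ.norm_eq]
    refine lintegral_mono fun X => ?_
    rw [← enorm_eq_nnnorm, ← ofReal_norm, ← ENNReal.ofReal_pow (norm_nonneg _)]
    exact ENNReal.ofReal_le_ofReal (pow_le_pow_left₀ (hg0 X) (hgle X) 2)
  have hnεtop : nε ≠ ⊤ := ne_top_of_le_ne_top ENNReal.one_ne_top hnε1
  have hlow : ENNReal.ofReal (1 - δ) ≤ nε := by
    -- pointwise on the box: `|ψ|² ≤ g² + 2εM`
    have hpt : ∀ X, ((‖ψ X‖₊ : ℝ≥0∞)) ^ 2 ≤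
        ENNReal.ofReal (g X ^ 2) + (boxN N L).indicator (fun _ => ENNReal.ofReal (2 * ε * M)) X := by
      intro X
      by_cases hX : X ∈ boxN N L
      · rw [indicator_of_mem hX, ← enorm_eq_nnnorm, ← ofReal_norm,
          ← ENNReal.ofReal_pow (norm_nonneg _), ← ENNReal.ofReal_add (sq_nonneg _) (by positivity)]
        refine ENNReal.ofReal_le_ofReal ?_
        have h1 : ‖ψ X‖ - g X ≤ ε := by have := norm_sub_le_smoothAbs (ε := ε) (ψ := ψ) X; linarith
        have h2 : ‖ψ X‖ ^ 2 - g X ^ 2 = (‖ψ X‖ - g X) * (‖ψ X‖ + g X) := by ring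
        nlinarith [hg0 X, hgle X, hM X, norm_nonneg (ψ X)]
      · rw [indicator_of_notMem hX, show ψ X = 0 from Φ.eq_zero X hX]
        simp
    have h1 : (1 : ℝ≥0∞) ≤ nε + ENNReal.ofReal (2 * ε * M) * volume (boxN N L) := by
      calc (1 : ℝ≥0∞) = ∫⁻ X, ((‖ψ X‖₊ : ℝ≥0∞)) ^ 2 := Φ.norm_eq.symm
        _ ≤ ∫⁻ X, (ENNReal.ofReal (g X ^ 2) +
              (boxN N L).indicator (fun _ => ENNReal.ofReal (2 * ε * M)) X) := lintegral_mono hpt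
        _ = nε + ENNReal.ofReal (2 * ε * M) * volume (boxN N L) := by
            rw [lintegral_add_left ((hgm.pow_const 2).ennreal_ofReal),
              lintegral_indicator (measurableSet_boxN N L), setLIntegral_const]
    have h2 : ENNReal.ofReal (2 * ε * M) * volume (boxN N L) ≤ ENNReal.ofReal δ := by
      rw [hvol, ← ENNReal.ofReal_mul (by positivity)]
      exact ENNReal.ofReal_le_ofReal (by nlinarith)
    have h3 : (1 : ℝ≥0∞) ≤ nε + ENNReal.ofReal δ := h1.trans (add_le_add le_rfl h2)
    rw [ENNReal.ofReal_sub _ hδ.le, ENNReal.ofReal_one]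
    exact tsub_le_iff_right.2 h3
  have hnε0 : nε ≠ 0 := by
    intro h0
    rw [h0] at hlow
    have : (0 : ℝ≥0∞) < ENNReal.ofReal (1 - δ) := ENNReal.ofReal_pos.2 (by linarith)
    exact absurd hlow (not_le.2 this)
  -- the normalising constant
  have hnεR : 0 < nε.toReal := ENNReal.toReal_pos hnε0 hnεtop
  set c : ℝ := (Real.sqrt nε.toReal)⁻¹ with hcdef
  have hc0 : 0 ≤ c := by rw [hcdef]; positivity
  have hc2 : ENNReal.ofReal (c ^ 2) = nε⁻¹ := by
    rw [hcdef, inv_pow, Real.sq_sqrt hnεR.le, ENNReal.ofReal_inv_of_pos hnεR, ENNReal.ofReal_toReal hnεtop]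
  have hnorm : ∫⁻ X, ((‖(((c * g X : ℝ)) : ℂ)‖₊ : ℝ≥0∞)) ^ 2 = 1 := by
    have h1 : ∀ X, ((‖(((c * g X : ℝ)) : ℂ)‖₊ : ℝ≥0∞)) ^ 2 =
        ENNReal.ofReal (c ^ 2) * ENNReal.ofReal (g X ^ 2) := fun X => by
      rw [ennnorm_sq_ofReal_periodic, mul_pow, ENNReal.ofReal_mul (sq_nonneg _)]
    simp_rw [h1]
    rw [lintegral_const_mul' _ _ ENNReal.ofReal_ne_top, hc2]
    exact ENNReal.inv_mul_cancel hnε0 hnεtop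
  -- the trial state
  let Φ' : TrialState N L :=
    { ψ := fun X => (((c * g X : ℝ)) : ℂ)
      contDiff := Complex.ofRealCLM.contDiff.comp (contDiff_const.mul hgC)
      eq_zero := fun X hX => by simp [hg0' X hX]
      symm := fun σ X => by
        show (((c * g (X ∘ σ) : ℝ)) : ℂ) = (((c * g X : ℝ)) : ℂ)
        simp only [hgdef, hψdef, Φ.symm σ X]
      norm_eq := hnorm }
  refine ⟨Φ', fun X => ?_, ?_⟩
  · show (((c * g X : ℝ)) : ℂ) = ((‖(((c * g X : ℝ)) : ℂ)‖ : ℝ) : ℂ)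
    rw [Complex.norm_real, Real.norm_of_nonneg (mul_nonneg hc0 (hg0 X))]
  · have hE := energy_le_of_contraction v Φ Φ' hgC rfl
      (fun X => realKinetic_smoothAbs_le (hψC.differentiable one_ne_zero) hε.ne' X)
      (fun X => by rw [abs_of_nonneg (hg0 X)]; exact hgle X)
    refine hE.trans ?_
    rw [hc2]
    exact mul_le_mul' (ENNReal.inv_le_inv.2 hlow) le_rfl

end Summit.AtomisticToContinuum.BoseEinsteinCondensation.Theorems.BECInsertionVariance

end
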